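import Summits.HodgeConjecture.HodgeConjecture.Theorems.F0P3Rung0HaarPackage      -- ★ p826197 (F0P3-p04 (g8)): the measure block of `stub_rung0` + its §1–§3 pieces
import HarnessLib

/-!
# Crux `H413` — the measure block of `Rung0Witness` WITH THE ARCHIMEDEAN HAAR FACTS EXPORTED (sibling of ★ `F0P3Rung0HaarPackage`, p826197)

F0∕P3a, cell `hodgecm-mathlib`, crux H413 (`stmt-HodgeConjecture-24833`); seat F0P3a-p04 (g9), on F0P3a-p01 (g8)'s `CENSUS-rung0-FEED` §4 gap (G-2)
(LEAD DESK WORD T6-25 (α)).  PROOF lane: theorems only (no `def`, no instance, no notation, no `sorry`), `--supports stmt-HodgeConjecture-24833`.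

THE GAP.  ★ `F0P3Rung0HaarPackage.exists_rung0HaarPackage` (p826197) exports the three archimedean measures `νGi` (on `G′_∞ = U(H)(L⁺ ⊗ ℝ)`), `νqi` (on
`G_∞ = U(Φ₃)(L⁺ ⊗ ℝ)`) and `νHi` (on `H_∞`) only as «finite on compacta ∧ right invariant» — the strengths the K9β structure `Rung0Witness` posits.  But the
T6-L2 pay-down head `Cruxes/H413/Lines/F0_P3a_ArchTransfersSingularPaydown.lean ∷ archTransfersExistCanonicalSingular_holds`, which is to feed `Rung0Witness.hAT₄`,
is framed with `[IsHaarMeasure]` instances on `ν′ := νGi`, `ν := νqi`, `νH := νHi` (T6a-TREE §4 (H): some stubs are false at the zero measure).  The witnesses of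
★ p826197 ARE Haar — ★ `exists_isHaarMeasure_arch_of_modularCharacterFun_eq_one` ∕ `…_arch_prod_…` return `μ.IsHaarMeasure` as their first conjunct and ★
`exists_isProductHaar` returns `νGi.IsHaarMeasure` — the facts were merely dropped on the way out.  This file re-assembles the package keeping them:

* `exists_rung0HaarPackage_of_haar (hH hHd hanis)` — ★ `exists_rung0HaarPackage_of`'s 23 conjuncts VERBATIM and in order, then
  `νGi.IsHaarMeasure ∧ νqi.IsHaarMeasure ∧ νHi.IsHaarMeasure` (Borel σ-algebras, `letI := borel _` as everywhere in the package);
* `exists_rung0HaarPackage_haar (ι T hT hdef h2)` — the same in the frame of the letters' line (★ `exists_rung0HaarPackage`'s hypotheses VERBATIM).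
A consumer replaces `obtain ⟨ν, …, hPH⟩ := exists_rung0HaarPackage …` by `obtain ⟨ν, …, hPH, hGiH, hqiH, hHiH⟩ := exists_rung0HaarPackage_haar …` and has
the three `haveI`s of the T6-L2 junction in hand.  Nothing printed is consumed; HONEST LABEL: HC_CM is proved only modulo the printed citations until rung 0
closes — this file is in-house measure theory (existence of Haar measures on real reductive groups, [Knapp2002 VIII §2], [BorelJacquet1979 §4.1]).

References: J. Rogawski, Ann. of Math. Stud. 123 (1990) §4.3 p. 44, §4.9 p. 54, §5.4 p. 72 [Rogawski1990]; J. Tate in Cassels–Fröhlich (1967) Ch. XV §3.3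
[CasselsFrohlichANT1967]; A. Borel, H. Jacquet, PSPM 33.1 (1979) §4.1 [BorelJacquet1979]; A. W. Knapp, *Lie Groups Beyond an Introduction* (2002) VIII §2
[Knapp2002].
-/

set_option autoImplicit false
-- the mandated namespace has the single-problem summit's repeated segment (`HodgeConjecture.HodgeConjecture`)
set_option linter.dupNamespace false

noncomputable section

namespace Summit.HodgeConjecture.HodgeConjecture.Cruxes.H413.F0P3Rung0HaarPackage

open MeasureTheory MeasureTheory.Measure NumberField IsDedekindDomain
open Literature.NumberTheory.Automorphic Literature.NumberTheory.Automorphic.UnitaryGroup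
open Literature.NumberTheory.Rogawski1990 (Gqs qsForm transpose_map_cmConjRingHom_eq_of_frame isUnit_det_of_frame)
open Summit.HodgeConjecture.HodgeConjecture.Cruxes.H413.F0P3InnerFormClassificationV6 (Gp)
open Summit.HodgeConjecture.HodgeConjecture.Cruxes.H413.F0P3LettersTraceFactorisation (IsProductHaar)
open scoped Matrix ComplexOrder

variable (L : Type) [Field L] [NumberField L] [IsCMField L] (H : Matrix (Fin 3) (Fin 3) L)

/-! ## §1 The same package with `νGi`, `νqi`, `νHi` exported AS HAAR MEASURES — the T6-L2 junction's instance strength -/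

/-- **The measure block WITH THE ARCHIMEDEAN HAAR FACTS EXPORTED.**  Same data and the same 23 conjuncts as ★ `exists_rung0HaarPackage_of`, in the
same order, followed by THREE more: `νGi`, `νqi`, `νHi` are HAAR measures (not merely finite on compacta and right invariant).  The constructions of ★ p826197
already are Haar (★ `exists_isHaarMeasure_arch_of_modularCharacterFun_eq_one` ∕ `…_prod_…` return `IsHaarMeasure` first; ★ `exists_isProductHaar` returns
`νGi.IsHaarMeasure`); ★ p826197 discarded these facts because `Rung0Witness` only posits `finCpt ∧ rightInv` for the three archimedean measures.  The T6-L2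
pay-down head `F0P3aArchTransfersSingularPaydown.archTransfersExistCanonicalSingular_holds` is framed with `[IsHaarMeasure]` on `ν′ := νGi`, `ν := νqi`,
`νH := νHi` (T6a-TREE §4 (H)), so a feed of `Rung0Witness.hAT₄` from that head at the package's witnesses needs exactly these three facts
(F0P3a-p01 (g8) `CENSUS-rung0-FEED` §4 (G-2)).  [cite: Rogawski1990, §4.3 p. 44; §4.9 p. 54; §5.4 p. 72] [cite: Knapp2002, VIII.§2 Cor. 8.31]
[cite: BorelJacquet1979, §4.1] -/
theorem exists_rung0HaarPackage_of_haar (hH : (H.map (cmConjRingHom L))ᵀ = H) (hHd : H.det ≠ 0)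
    (hanis : ∀ x : Fin 3 → L, hermForm (cmConjRingHom L) H x x = 0 → x = 0) :
    ∃ (ν : @Measure (cmDatum L 3 H).Adelic (borel _))
      (νH : ∀ v : HeightOneSpectrum (𝓞 ↥(maximalRealSubfield L)),
        @Measure ((cmDatum L 2 (Matrix.of fun i j : Fin 2 => if i.val + j.val + 1 = 2 then (1 : L) else 0)).Local v ×
          (cmDatum L 1 (Matrix.of fun i j : Fin 1 => if i.val + j.val + 1 = 1 then (1 : L) else 0)).Local v) (borel _))
      (νG : ∀ v : HeightOneSpectrum (𝓞 ↥(maximalRealSubfield L)), @Measure ((cmDatum L 3 H).Local v) (borel _))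
      (νGi : @Measure ↥(UnitaryGroup.arch (↥(maximalRealSubfield L)) L (IsCMField.complexConj L) 3 H) (borel _))
      (νqi : @Measure ↥(UnitaryGroup.arch (↥(maximalRealSubfield L)) L (IsCMField.complexConj L) 3
        (Matrix.of fun i j : Fin 3 => if i.val + j.val + 1 = 3 then (1 : L) else 0)) (borel _))
      (νHi : @Measure (↥(UnitaryGroup.arch (↥(maximalRealSubfield L)) L (IsCMField.complexConj L) 2
          (Matrix.of fun i j : Fin 2 => if i.val + j.val + 1 = 2 then (1 : L) else 0)) ×
        ↥(UnitaryGroup.arch (↥(maximalRealSubfield L)) L (IsCMField.complexConj L) 1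
          (Matrix.of fun i j : Fin 1 => if i.val + j.val + 1 = 1 then (1 : L) else 0))) (borel _))
      (μZ : ∀ v : HeightOneSpectrum (𝓞 ↥(maximalRealSubfield L)), @Measure (Gqs L v ⧸ Subgroup.center (Gqs L v)) (borel _)),
      -- `isHaar_ν`
      (letI : MeasurableSpace (cmDatum L 3 H).Adelic := borel _; ν.IsHaarMeasure) ∧
      -- `isInvInv_ν`
      (letI : MeasurableSpace (cmDatum L 3 H).Adelic := borel _; ν.IsInvInvariant) ∧
      -- `isHaar_νH`
      (∀ v : HeightOneSpectrum (𝓞 ↥(maximalRealSubfield L)),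
        letI : MeasurableSpace ((cmDatum L 2 (Matrix.of fun i j : Fin 2 => if i.val + j.val + 1 = 2 then (1 : L) else 0)).Local v ×
          (cmDatum L 1 (Matrix.of fun i j : Fin 1 => if i.val + j.val + 1 = 1 then (1 : L) else 0)).Local v) := borel _; (νH v).IsHaarMeasure) ∧
      -- `isRightInv_νH`
      (∀ v : HeightOneSpectrum (𝓞 ↥(maximalRealSubfield L)),
        letI : MeasurableSpace ((cmDatum L 2 (Matrix.of fun i j : Fin 2 => if i.val + j.val + 1 = 2 then (1 : L) else 0)).Local v ×
          (cmDatum L 1 (Matrix.of fun i j : Fin 1 => if i.val + j.val + 1 = 1 then (1 : L) else 0)).Local v) := borel _; (νH v).IsMulRightInvariant) ∧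
      -- `isHaar_νG`
      (∀ v : HeightOneSpectrum (𝓞 ↥(maximalRealSubfield L)), letI : MeasurableSpace ((cmDatum L 3 H).Local v) := borel _; (νG v).IsHaarMeasure) ∧
      -- `isRightInv_νG`
      (∀ v : HeightOneSpectrum (𝓞 ↥(maximalRealSubfield L)), letI : MeasurableSpace ((cmDatum L 3 H).Local v) := borel _; (νG v).IsMulRightInvariant) ∧
      -- `hK`
      (∀ v : HeightOneSpectrum (𝓞 ↥(maximalRealSubfield L)), νG v (cmLocalIntegralLevel L 3 H v : Set ((cmDatum L 3 H).Local v)) = 1) ∧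
      -- `hKH`
      (∀ v : HeightOneSpectrum (𝓞 ↥(maximalRealSubfield L)),
        νH v (((cmLocalIntegralLevel L 2 (Matrix.of fun i j : Fin 2 => if i.val + j.val + 1 = 2 then (1 : L) else 0) v).prod
            (cmLocalIntegralLevel L 1 (Matrix.of fun i j : Fin 1 => if i.val + j.val + 1 = 1 then (1 : L) else 0) v) :
              Subgroup ((cmDatum L 2 (Matrix.of fun i j : Fin 2 => if i.val + j.val + 1 = 2 then (1 : L) else 0)).Local v ×
                (cmDatum L 1 (Matrix.of fun i j : Fin 1 => if i.val + j.val + 1 = 1 then (1 : L) else 0)).Local v)) :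
            Set ((cmDatum L 2 (Matrix.of fun i j : Fin 2 => if i.val + j.val + 1 = 2 then (1 : L) else 0)).Local v ×
              (cmDatum L 1 (Matrix.of fun i j : Fin 1 => if i.val + j.val + 1 = 1 then (1 : L) else 0)).Local v)) = 1) ∧
      -- `finCpt_νGi`
      (letI : MeasurableSpace ↥(UnitaryGroup.arch (↥(maximalRealSubfield L)) L (IsCMField.complexConj L) 3 H) := borel _; IsFiniteMeasureOnCompacts νGi) ∧
      -- `rightInv_νGi`
      (letI : MeasurableSpace ↥(UnitaryGroup.arch (↥(maximalRealSubfield L)) L (IsCMField.complexConj L) 3 H) := borel _; νGi.IsMulRightInvariant) ∧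
      -- `finCpt_νqi`
      (letI : MeasurableSpace ↥(UnitaryGroup.arch (↥(maximalRealSubfield L)) L (IsCMField.complexConj L) 3
        (Matrix.of fun i j : Fin 3 => if i.val + j.val + 1 = 3 then (1 : L) else 0)) := borel _; IsFiniteMeasureOnCompacts νqi) ∧
      -- `rightInv_νqi`
      (letI : MeasurableSpace ↥(UnitaryGroup.arch (↥(maximalRealSubfield L)) L (IsCMField.complexConj L) 3
        (Matrix.of fun i j : Fin 3 => if i.val + j.val + 1 = 3 then (1 : L) else 0)) := borel _; νqi.IsMulRightInvariant) ∧
      -- `finCpt_νHi`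
      (letI : MeasurableSpace (↥(UnitaryGroup.arch (↥(maximalRealSubfield L)) L (IsCMField.complexConj L) 2
          (Matrix.of fun i j : Fin 2 => if i.val + j.val + 1 = 2 then (1 : L) else 0)) ×
        ↥(UnitaryGroup.arch (↥(maximalRealSubfield L)) L (IsCMField.complexConj L) 1
          (Matrix.of fun i j : Fin 1 => if i.val + j.val + 1 = 1 then (1 : L) else 0))) := borel _; IsFiniteMeasureOnCompacts νHi) ∧
      -- `rightInv_νHi`
      (letI : MeasurableSpace (↥(UnitaryGroup.arch (↥(maximalRealSubfield L)) L (IsCMField.complexConj L) 2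
          (Matrix.of fun i j : Fin 2 => if i.val + j.val + 1 = 2 then (1 : L) else 0)) ×
        ↥(UnitaryGroup.arch (↥(maximalRealSubfield L)) L (IsCMField.complexConj L) 1
          (Matrix.of fun i j : Fin 1 => if i.val + j.val + 1 = 1 then (1 : L) else 0))) := borel _; νHi.IsMulRightInvariant) ∧
      -- `isHaar_μZ`
      (∀ v : HeightOneSpectrum (𝓞 ↥(maximalRealSubfield L)),
        letI : MeasurableSpace (Gqs L v ⧸ Subgroup.center (Gqs L v)) := borel _; (μZ v).IsHaarMeasure) ∧
      -- `hPH`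
      (letI : MeasurableSpace (Gp L H).Adelic := borel _; IsProductHaar L H ν νGi νG) ∧
      -- NEW: the three archimedean measures ARE Haar (T6-L2's frame `[IsHaarMeasure]` on `ν′ := νGi`, `ν := νqi`, `νH := νHi`)
      (letI : MeasurableSpace ↥(UnitaryGroup.arch (↥(maximalRealSubfield L)) L (IsCMField.complexConj L) 3 H) := borel _; νGi.IsHaarMeasure) ∧
      (letI : MeasurableSpace ↥(UnitaryGroup.arch (↥(maximalRealSubfield L)) L (IsCMField.complexConj L) 3
        (Matrix.of fun i j : Fin 3 => if i.val + j.val + 1 = 3 then (1 : L) else 0)) := borel _; νqi.IsHaarMeasure) ∧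
      (letI : MeasurableSpace (↥(UnitaryGroup.arch (↥(maximalRealSubfield L)) L (IsCMField.complexConj L) 2
          (Matrix.of fun i j : Fin 2 => if i.val + j.val + 1 = 2 then (1 : L) else 0)) ×
        ↥(UnitaryGroup.arch (↥(maximalRealSubfield L)) L (IsCMField.complexConj L) 1
          (Matrix.of fun i j : Fin 1 => if i.val + j.val + 1 = 1 then (1 : L) else 0))) := borel _; νHi.IsHaarMeasure) := by
  obtain ⟨νG, hνG, hνGr, hK⟩ := exists_isHaarMeasure_family_local L H hH hHd
  obtain ⟨νH, hνH, hνHr, hKH⟩ := exists_isHaarMeasure_family_localEndoscopic L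
  obtain ⟨ν, νGi, hν, hνi, hνGi, hPH⟩ := exists_isProductHaar L H hanis νG hνG hK
  obtain ⟨νqi, hνqiH, hνqic, hνqir⟩ := exists_isHaarMeasure_arch_of_modularCharacterFun_eq_one L
    (Matrix.of fun i j : Fin 3 => if i.val + j.val + 1 = 3 then (1 : L) else 0) (modularCharacterFun_arch_antidiagOne_eq_one L 3)
  obtain ⟨νHi, hνHiH, hνHic, hνHir⟩ := exists_isHaarMeasure_arch_prod_of_modularCharacterFun_eq_one L
    (Matrix.of fun i j : Fin 2 => if i.val + j.val + 1 = 2 then (1 : L) else 0) (Matrix.of fun i j : Fin 1 => if i.val + j.val + 1 = 1 then (1 : L) else 0)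
    (modularCharacterFun_arch_endoscopic_eq_one L)
  have hμZ := fun v : HeightOneSpectrum (𝓞 ↥(maximalRealSubfield L)) => exists_isHaarMeasure_gqs_quotient_center L v
  choose μZ hμZ using hμZ
  -- `νGi`: finite on compacta (Haar) and right invariant (`U(H)(L⁺ ⊗ ℝ)` unimodular)
  have hνGic : letI : MeasurableSpace ↥(UnitaryGroup.arch (↥(maximalRealSubfield L)) L (IsCMField.complexConj L) 3 H) := borel _;
      IsFiniteMeasureOnCompacts νGi := by
    letI : MeasurableSpace ↥(UnitaryGroup.arch (↥(maximalRealSubfield L)) L (IsCMField.complexConj L) 3 H) := borel _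
    haveI := hνGi
    infer_instance
  have hνGir : letI : MeasurableSpace ↥(UnitaryGroup.arch (↥(maximalRealSubfield L)) L (IsCMField.complexConj L) 3 H) := borel _;
      νGi.IsMulRightInvariant := by
    letI : MeasurableSpace ↥(UnitaryGroup.arch (↥(maximalRealSubfield L)) L (IsCMField.complexConj L) 3 H) := borel _
    haveI : BorelSpace ↥(UnitaryGroup.arch (↥(maximalRealSubfield L)) L (IsCMField.complexConj L) 3 H) := ⟨rfl⟩
    haveI := hνGi
    exact isMulRightInvariant_of_modularCharacterFun_eq_one (modularCharacterFun_arch_eq_one L H hH hHd) νGi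
  exact ⟨ν, νH, νG, νGi, νqi, νHi, μZ, hν, hνi, hνH, hνHr, hνG, hνGr, hK, hKH, hνGic, hνGir, hνqic, hνqir, hνHic, hνHir, hμZ, hPH,
    hνGi, hνqiH, hνHiH⟩

/-- **THE MEASURE BLOCK OF `stub_rung0` IN THE FRAME OF THE LETTERS' LINE, WITH THE ARCHIMEDEAN HAAR FACTS EXPORTED**: ★ `exists_rung0HaarPackage`'s
23 conjuncts in order, then `νGi.IsHaarMeasure ∧ νqi.IsHaarMeasure ∧ νHi.IsHaarMeasure` — the instance strength the T6-L2 head asks of `ν′ νGi`, `ν := νqi`,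
`νH := νHi` at the `hAT₄` feed.  One `obtain` with three more names discharges the sixteen measure fields + `hPH` of `Rung0Witness` AND supplies the
`haveI`s of the T6-L2 junction. [cite: Rogawski1990, §4.3 p. 44; §4.9 p. 54; §5.4 p. 72] [cite: CasselsFrohlichANT1967, Ch. XV (Tate) §3.3] [cite: BorelJacquet1979, §4.1] -/
theorem exists_rung0HaarPackage_haar (ι : L →+* ℂ) (T : GL (Fin 3) ℂ)
    (hT : (T : Matrix (Fin 3) (Fin 3) ℂ)ᴴ * H.map ι * (T : Matrix (Fin 3) (Fin 3) ℂ) = Literature.Geometry.ComplexHyperbolic.BallModel.J)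
    (hdef : ∀ τ' : L →+* ℂ, InfinitePlace.mk τ' ≠ InfinitePlace.mk ι → (H.map τ').PosDef)
    (h2 : 2 ≤ Module.finrank ℚ ↥(maximalRealSubfield L)) :
    ∃ (ν : @Measure (cmDatum L 3 H).Adelic (borel _))
      (νH : ∀ v : HeightOneSpectrum (𝓞 ↥(maximalRealSubfield L)),
        @Measure ((cmDatum L 2 (Matrix.of fun i j : Fin 2 => if i.val + j.val + 1 = 2 then (1 : L) else 0)).Local v ×
          (cmDatum L 1 (Matrix.of fun i j : Fin 1 => if i.val + j.val + 1 = 1 then (1 : L) else 0)).Local v) (borel _))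
      (νG : ∀ v : HeightOneSpectrum (𝓞 ↥(maximalRealSubfield L)), @Measure ((cmDatum L 3 H).Local v) (borel _))
      (νGi : @Measure ↥(UnitaryGroup.arch (↥(maximalRealSubfield L)) L (IsCMField.complexConj L) 3 H) (borel _))
      (νqi : @Measure ↥(UnitaryGroup.arch (↥(maximalRealSubfield L)) L (IsCMField.complexConj L) 3
        (Matrix.of fun i j : Fin 3 => if i.val + j.val + 1 = 3 then (1 : L) else 0)) (borel _))
      (νHi : @Measure (↥(UnitaryGroup.arch (↥(maximalRealSubfield L)) L (IsCMField.complexConj L) 2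
          (Matrix.of fun i j : Fin 2 => if i.val + j.val + 1 = 2 then (1 : L) else 0)) ×
        ↥(UnitaryGroup.arch (↥(maximalRealSubfield L)) L (IsCMField.complexConj L) 1
          (Matrix.of fun i j : Fin 1 => if i.val + j.val + 1 = 1 then (1 : L) else 0))) (borel _))
      (μZ : ∀ v : HeightOneSpectrum (𝓞 ↥(maximalRealSubfield L)), @Measure (Gqs L v ⧸ Subgroup.center (Gqs L v)) (borel _)),
      (letI : MeasurableSpace (cmDatum L 3 H).Adelic := borel _; ν.IsHaarMeasure) ∧
      (letI : MeasurableSpace (cmDatum L 3 H).Adelic := borel _; ν.IsInvInvariant) ∧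
      (∀ v : HeightOneSpectrum (𝓞 ↥(maximalRealSubfield L)),
        letI : MeasurableSpace ((cmDatum L 2 (Matrix.of fun i j : Fin 2 => if i.val + j.val + 1 = 2 then (1 : L) else 0)).Local v ×
          (cmDatum L 1 (Matrix.of fun i j : Fin 1 => if i.val + j.val + 1 = 1 then (1 : L) else 0)).Local v) := borel _; (νH v).IsHaarMeasure) ∧
      (∀ v : HeightOneSpectrum (𝓞 ↥(maximalRealSubfield L)),
        letI : MeasurableSpace ((cmDatum L 2 (Matrix.of fun i j : Fin 2 => if i.val + j.val + 1 = 2 then (1 : L) else 0)).Local v ×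
          (cmDatum L 1 (Matrix.of fun i j : Fin 1 => if i.val + j.val + 1 = 1 then (1 : L) else 0)).Local v) := borel _; (νH v).IsMulRightInvariant) ∧
      (∀ v : HeightOneSpectrum (𝓞 ↥(maximalRealSubfield L)), letI : MeasurableSpace ((cmDatum L 3 H).Local v) := borel _; (νG v).IsHaarMeasure) ∧
      (∀ v : HeightOneSpectrum (𝓞 ↥(maximalRealSubfield L)), letI : MeasurableSpace ((cmDatum L 3 H).Local v) := borel _; (νG v).IsMulRightInvariant) ∧
      (∀ v : HeightOneSpectrum (𝓞 ↥(maximalRealSubfield L)), νG v (cmLocalIntegralLevel L 3 H v : Set ((cmDatum L 3 H).Local v)) = 1) ∧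
      (∀ v : HeightOneSpectrum (𝓞 ↥(maximalRealSubfield L)),
        νH v (((cmLocalIntegralLevel L 2 (Matrix.of fun i j : Fin 2 => if i.val + j.val + 1 = 2 then (1 : L) else 0) v).prod
            (cmLocalIntegralLevel L 1 (Matrix.of fun i j : Fin 1 => if i.val + j.val + 1 = 1 then (1 : L) else 0) v) :
              Subgroup ((cmDatum L 2 (Matrix.of fun i j : Fin 2 => if i.val + j.val + 1 = 2 then (1 : L) else 0)).Local v ×
                (cmDatum L 1 (Matrix.of fun i j : Fin 1 => if i.val + j.val + 1 = 1 then (1 : L) else 0)).Local v)) :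
            Set ((cmDatum L 2 (Matrix.of fun i j : Fin 2 => if i.val + j.val + 1 = 2 then (1 : L) else 0)).Local v ×
              (cmDatum L 1 (Matrix.of fun i j : Fin 1 => if i.val + j.val + 1 = 1 then (1 : L) else 0)).Local v)) = 1) ∧
      (letI : MeasurableSpace ↥(UnitaryGroup.arch (↥(maximalRealSubfield L)) L (IsCMField.complexConj L) 3 H) := borel _; IsFiniteMeasureOnCompacts νGi) ∧
      (letI : MeasurableSpace ↥(UnitaryGroup.arch (↥(maximalRealSubfield L)) L (IsCMField.complexConj L) 3 H) := borel _; νGi.IsMulRightInvariant) ∧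
      (letI : MeasurableSpace ↥(UnitaryGroup.arch (↥(maximalRealSubfield L)) L (IsCMField.complexConj L) 3
        (Matrix.of fun i j : Fin 3 => if i.val + j.val + 1 = 3 then (1 : L) else 0)) := borel _; IsFiniteMeasureOnCompacts νqi) ∧
      (letI : MeasurableSpace ↥(UnitaryGroup.arch (↥(maximalRealSubfield L)) L (IsCMField.complexConj L) 3
        (Matrix.of fun i j : Fin 3 => if i.val + j.val + 1 = 3 then (1 : L) else 0)) := borel _; νqi.IsMulRightInvariant) ∧
      (letI : MeasurableSpace (↥(UnitaryGroup.arch (↥(maximalRealSubfield L)) L (IsCMField.complexConj L) 2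
          (Matrix.of fun i j : Fin 2 => if i.val + j.val + 1 = 2 then (1 : L) else 0)) ×
        ↥(UnitaryGroup.arch (↥(maximalRealSubfield L)) L (IsCMField.complexConj L) 1
          (Matrix.of fun i j : Fin 1 => if i.val + j.val + 1 = 1 then (1 : L) else 0))) := borel _; IsFiniteMeasureOnCompacts νHi) ∧
      (letI : MeasurableSpace (↥(UnitaryGroup.arch (↥(maximalRealSubfield L)) L (IsCMField.complexConj L) 2
          (Matrix.of fun i j : Fin 2 => if i.val + j.val + 1 = 2 then (1 : L) else 0)) ×
        ↥(UnitaryGroup.arch (↥(maximalRealSubfield L)) L (IsCMField.complexConj L) 1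
          (Matrix.of fun i j : Fin 1 => if i.val + j.val + 1 = 1 then (1 : L) else 0))) := borel _; νHi.IsMulRightInvariant) ∧
      (∀ v : HeightOneSpectrum (𝓞 ↥(maximalRealSubfield L)),
        letI : MeasurableSpace (Gqs L v ⧸ Subgroup.center (Gqs L v)) := borel _; (μZ v).IsHaarMeasure) ∧
      (letI : MeasurableSpace (Gp L H).Adelic := borel _; IsProductHaar L H ν νGi νG) ∧
      -- NEW: the three archimedean measures ARE Haar (T6-L2's frame `[IsHaarMeasure]` on `ν′ := νGi`, `ν := νqi`, `νH := νHi`)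
      (letI : MeasurableSpace ↥(UnitaryGroup.arch (↥(maximalRealSubfield L)) L (IsCMField.complexConj L) 3 H) := borel _; νGi.IsHaarMeasure) ∧
      (letI : MeasurableSpace ↥(UnitaryGroup.arch (↥(maximalRealSubfield L)) L (IsCMField.complexConj L) 3
        (Matrix.of fun i j : Fin 3 => if i.val + j.val + 1 = 3 then (1 : L) else 0)) := borel _; νqi.IsHaarMeasure) ∧
      (letI : MeasurableSpace (↥(UnitaryGroup.arch (↥(maximalRealSubfield L)) L (IsCMField.complexConj L) 2
          (Matrix.of fun i j : Fin 2 => if i.val + j.val + 1 = 2 then (1 : L) else 0)) ×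
        ↥(UnitaryGroup.arch (↥(maximalRealSubfield L)) L (IsCMField.complexConj L) 1
          (Matrix.of fun i j : Fin 1 => if i.val + j.val + 1 = 1 then (1 : L) else 0))) := borel _; νHi.IsHaarMeasure) :=
  exists_rung0HaarPackage_of_haar L H (transpose_map_cmConjRingHom_eq_of_frame L ι H T hT) (isUnit_det_of_frame L ι H T hT).ne_zero
    (F0P3ClassTokensOfRecord.anisotropic_of_frame L H ι hdef h2)

end Summit.HodgeConjecture.HodgeConjecture.Cruxes.H413.F0P3Rung0HaarPackage

end
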